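import Summits.Langlands.Langlands.Theses.SmithKummerSeed
import Summits.Langlands.Langlands.Theorems.BaseFieldAscentAscentResidualLayers

/-!
# The four-piece split of `SmithKummerSeed.AscentResidual`, by name

Crux-strategist r1 (REDIRECT) on stmt-Langlands-1095. The landed layer glue
`Summit.Langlands.Langlands.Theorems.AscentResidual.stub_ascentResidualOfLayers` (p151576; Jordan–Hölder layer induction
`numberField_induction_simpleLayers`, the crux's hypothesis consumed only at the degree-one fields) has, up to δ-unfolding,
the type `CyclicPrimeAscent → CyclicPrimeDescent → SimpleLayerAscent → SimpleLayerDescent → AscentResidual` over the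
route decls of `Summits/Langlands/Langlands/Theses/SmithKummerSeed.lean` (rev 10: items stmt-Langlands-18649, 18645,
19458, 19462 → 1095). This file records that assembly BY NAME, as the `--glue-by` target of
`ledger route edit route-Langlands-SmithKummerSeed --split AscentResidual --into … --glue-by
Summit.Langlands.Langlands.Theorems.SmithKummerSeedAscentResidualSplit.AscentResidual_of_pieces`
(report: `Cruxes/AscentResidual/Split.md`).
-/

set_option linter.dupNamespace false

namespace Summit.Langlands.Langlands.Theorems.SmithKummerSeedAscentResidualSplit

open Summit.Langlands.Langlands.Theses.SmithKummerSeed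

/-- **AscentResidual from its four layer pieces** (BC2 (b): the assembly `X_of : X₁ → X₂ → X₃ → X₄ → X`, proved):
reciprocity ascends and descends prime-cyclic Galois layers (`CyclicPrimeAscent`, `CyclicPrimeDescent`) and Galois layers with
non-abelian simple group (`SimpleLayerAscent`, `SimpleLayerDescent`) ⇒ reciprocity over all conjugation-solvable fields implies
reciprocity over every number field — by the landed `stub_ascentResidualOfLayers`. [folklore] -/
theorem AscentResidual_of_pieces (h₁ : CyclicPrimeAscent) (h₂ : CyclicPrimeDescent) (h₃ : SimpleLayerAscent)
    (h₄ : SimpleLayerDescent) : AscentResidual :=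
  Summit.Langlands.Langlands.Theorems.AscentResidual.stub_ascentResidualOfLayers h₁ h₂ h₃ h₄


end Summit.Langlands.Langlands.Theorems.SmithKummerSeedAscentResidualSplit
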